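import Literature.Analysis.FluidPDE.GaussianVortexPlanarProofs
import Literature.Analysis.FluidPDE.BiotSavart2DSymmetry
import Literature.Analysis.FluidPDE.GaussianVortexKernelRadial
import Mathlib.Analysis.Calculus.LineDeriv.IntegrationByParts
import HarnessLib

/-!
# The angular derivative `∂_θ = x^⊥·∇` on `ℝ²`: skew-symmetry, radial weights, and the
# linearised Burgers operator `Λ` as `Ω ∂_θ`

Analysis/FluidPDE file (all results proved, no definitions, no named facts). The angular
derivative of a function on the plane is written `∂_θ g (x) = Dg(x)[x^⊥]` (`perp x = (−x₁, x₀)`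
of `GaussianVortexPlanar`). We prove:

* `fderiv_normSq_comp_perp`, `fderiv_perp_eq_zero_of_radial` — radial functions
  `x ↦ F(|x|²)` have `∂_θ = 0`;
* `integral_mul_fderiv_perp_eq_neg` — **skew-symmetry of `∂_θ` on `L²(ℝ²)`**:
  `∫ f ∂_θh = −∫ (∂_θ f) h` for `C¹` functions with `|x|(|f||h| + |f||Dh| + |Df||h|) ∈ L¹`
  (two coordinate integrations by parts, Mathlib's
  `integral_mul_fderiv_eq_neg_fderiv_mul_of_integrable`; `div x^⊥ = 0`);
* `integral_mul_mul_fderiv_perp_eq_zero` — hence `∫ F g ∂_θ g = 0` for every `C¹` weight `F`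
  with `∂_θF = 0` (in particular every radial weight): the identity behind
  `⟨Ω∂_θu, F(|x|) u⟩ = 0`;
* `gaussLambda_eq_mul_fderiv_perp` — **Maekawa's right skew-symmetrizer in pointwise form**:
  for the linearisation `Λw = v^G·∇w + (K_{2D}∗w)·∇G` of the vortex nonlinearity at the Gaussian
  `G` (Maekawa 2009, §1: `Λ = Λ_G`; `v^G = Ω ξ^⊥`, `Ω = (8π)⁻¹φ(|ξ|²/4)`, `gaussVortexVelocity`)
  and ANY function `ψ` with `Dψ(ξ)[ξ^⊥] = −⟪(K_{2D}∗w)(ξ), ξ⟫` (e.g. the logarithmic potential,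
  `∇ψ = −v^⊥`, `PlanarLogPotential`),
  `Λw(ξ) = Ω(ξ) · ∂_θ(w + Φ ψ)(ξ)`, `Φ = G/(2Ω) = kerWeight`
  (`GaussianVortexKernelRadial`). This is the factorisation `Λ = Λ_a T⁻¹`, `Λ_a = Ω∂_θ`
  skew-symmetric in every radially weighted `L²`, `T⁻¹ = I + Λ_a⁻¹Λ_b`, of Maekawa 2009,
  Lemma 1.1 and §3 (there via angular Fourier modes and the Fredholm alternative), obtained here
  by the one-line computation `(K_{2D}∗w)·∇G = −(G/2) ξ·v = (G/2) ∂_θψ`.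

## References

* Y. Maekawa, *Existence of asymmetric Burgers vortices and their asymptotic behavior at large
  circulations*, Math. Models Methods Appl. Sci. 19 (2009) 669–705, §1 Lemma 1.1, §2.2, §3.
  [Maekawa2009b]
* Th. Gallay, Y. Maekawa, *Existence and stability of viscous vortices*, arXiv:1610.08384, §4.1
  (the skew-symmetrizer `T`). [GallayMaekawa2016]
-/

open MeasureTheory Filter Set Metric Function
open scoped Real RealInnerProductSpace Topology InnerProductSpace

noncomputable section

namespace Literature.Analysis.FluidPDE

/-! ### Radial functions have vanishing angular derivative -/

/-- `D(|·|²)(x)[x^⊥] = 2⟪x, x^⊥⟫ = 0`. [folklore] -/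
theorem fderiv_normSq_comp_perp (x : EuclideanSpace ℝ (Fin 2)) :
    fderiv ℝ (fun y : EuclideanSpace ℝ (Fin 2) => ‖y‖ ^ 2) x (perp x) = 0 := by
  rw [((hasStrictFDerivAt_norm_sq x).hasFDerivAt).fderiv]
  simp [inner_perp_self_right]

/-- **Radial functions have `∂_θ = 0`**: for `F : ℝ → ℝ` differentiable at `|x|²`,
`D(F(|·|²))(x)[x^⊥] = 0`. [folklore] -/
theorem fderiv_perp_eq_zero_of_radial {F : ℝ → ℝ} {x : EuclideanSpace ℝ (Fin 2)}
    (hF : DifferentiableAt ℝ F (‖x‖ ^ 2)) :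
    fderiv ℝ (fun y : EuclideanSpace ℝ (Fin 2) => F (‖y‖ ^ 2)) x (perp x) = 0 := by
  have hn : DifferentiableAt ℝ (fun y : EuclideanSpace ℝ (Fin 2) => ‖y‖ ^ 2) x :=
    (hasStrictFDerivAt_norm_sq x).hasFDerivAt.differentiableAt
  rw [show (fun y : EuclideanSpace ℝ (Fin 2) => F (‖y‖ ^ 2)) =
      F ∘ fun y : EuclideanSpace ℝ (Fin 2) => ‖y‖ ^ 2 from rfl,
    fderiv_comp x hF hn, ContinuousLinearMap.comp_apply, fderiv_normSq_comp_perp, map_zero]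

/-! ### Skew-symmetry of `∂_θ` -/

/-- The angular derivative in coordinates: `Dh(x)[x^⊥] = −x₁ ∂₀h(x) + x₀ ∂₁h(x)`. [folklore] -/
theorem fderiv_perp_eq_coord (h : EuclideanSpace ℝ (Fin 2) → ℝ) (x : EuclideanSpace ℝ (Fin 2)) :
    fderiv ℝ h x (perp x) = -(x 1 * fderiv ℝ h x (EuclideanSpace.single 0 1)) +
      x 0 * fderiv ℝ h x (EuclideanSpace.single 1 1) := by
  have e : perp x = (-x 1) • EuclideanSpace.single (0 : Fin 2) (1 : ℝ) +
      (x 0) • EuclideanSpace.single (1 : Fin 2) (1 : ℝ) := by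
    ext j; fin_cases j <;> simp
  rw [e, map_add, map_smul, map_smul, smul_eq_mul, smul_eq_mul]
  ring

section Skew

variable {f h : EuclideanSpace ℝ (Fin 2) → ℝ} (hf : ContDiff ℝ 1 f) (hh : ContDiff ℝ 1 h)
  (hfh : Integrable fun x => ‖x‖ * (|f x| * |h x|))
  (hfh' : Integrable fun x => ‖x‖ * (|f x| * ‖fderiv ℝ h x‖))
  (hf'h : Integrable fun x => ‖x‖ * (‖fderiv ℝ f x‖ * |h x|))
include hf hh hfh hfh' hf'h

/-- One coordinate integration by parts with a linear weight: for `i ≠ j`,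
`∫ (xⱼ f) ∂ᵢh = −∫ xⱼ (∂ᵢf) h` (`∂ᵢxⱼ = 0`). [folklore] -/
theorem integral_coord_mul_mul_fderiv_eq {i j : Fin 2} (hij : i ≠ j) :
    ∫ x, x j * f x * fderiv ℝ h x (EuclideanSpace.single i 1) =
      -∫ x, x j * fderiv ℝ f x (EuclideanSpace.single i 1) * h x := by
  -- the weighted function `F(x) = xⱼ f(x)` and its `i`-th partial derivative
  set F : EuclideanSpace ℝ (Fin 2) → ℝ := fun x => x j * f x with hF
  have hpj : ContDiff ℝ 1 fun x : EuclideanSpace ℝ (Fin 2) => x j :=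
    (EuclideanSpace.proj (j : Fin 2) : EuclideanSpace ℝ (Fin 2) →L[ℝ] ℝ).contDiff
  have hFc : ContDiff ℝ 1 F := hpj.mul hf
  have hFd : ∀ x, fderiv ℝ F x (EuclideanSpace.single i 1) =
      x j * fderiv ℝ f x (EuclideanSpace.single i 1) := by
    intro x
    have h1 : HasFDerivAt (fun x : EuclideanSpace ℝ (Fin 2) => x j)
        (EuclideanSpace.proj j : EuclideanSpace ℝ (Fin 2) →L[ℝ] ℝ) x :=
      (EuclideanSpace.proj (j : Fin 2) : EuclideanSpace ℝ (Fin 2) →L[ℝ] ℝ).hasFDerivAt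
    have h2 : HasFDerivAt f (fderiv ℝ f x) x :=
      ((hf.differentiable one_ne_zero) x).hasFDerivAt
    rw [hF, (h1.fun_mul h2).fderiv]
    simp [hij.symm]
  have hb : ∀ x : EuclideanSpace ℝ (Fin 2), |x j| ≤ ‖x‖ := fun x => by
    simpa using PiLp.norm_apply_le x j
  have he : ∀ (g : EuclideanSpace ℝ (Fin 2) → ℝ) (x : EuclideanSpace ℝ (Fin 2)),
      |fderiv ℝ g x (EuclideanSpace.single i 1)| ≤ ‖fderiv ℝ g x‖ := fun g x => by
    have := (fderiv ℝ g x).le_opNorm (EuclideanSpace.single i 1)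
    have hn : ‖EuclideanSpace.single i (1 : ℝ)‖ = 1 := by simp
    rw [hn, mul_one] at this
    simpa using this
  -- the three integrability conditions of the integration by parts
  have hcf' : Continuous fun x => fderiv ℝ f x (EuclideanSpace.single i 1) :=
    (hf.continuous_fderiv one_ne_zero).clm_apply continuous_const
  have hch' : Continuous fun x => fderiv ℝ h x (EuclideanSpace.single i 1) :=
    (hh.continuous_fderiv one_ne_zero).clm_apply continuous_const
  have i1 : Integrable fun x => fderiv ℝ F x (EuclideanSpace.single i 1) * h x := by
    simp_rw [hFd]
    refine hf'h.mono' (((hpj.continuous.mul hcf').mul hh.continuous).aestronglyMeasurable)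
      (Eventually.of_forall fun x => ?_)
    rw [Real.norm_eq_abs, abs_mul, abs_mul, mul_assoc]
    exact mul_le_mul (hb x) (mul_le_mul_of_nonneg_right (he f x) (abs_nonneg _))
      (by positivity) (norm_nonneg _)
  have i2 : Integrable fun x => F x * fderiv ℝ h x (EuclideanSpace.single i 1) := by
    refine hfh'.mono' ((hFc.continuous.mul hch').aestronglyMeasurable)
      (Eventually.of_forall fun x => ?_)
    rw [Real.norm_eq_abs, abs_mul, hF, abs_mul]
    simp only
    rw [mul_assoc]
    exact mul_le_mul (hb x) (mul_le_mul_of_nonneg_left (he h x) (abs_nonneg _))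
      (by positivity) (norm_nonneg _)
  have i3 : Integrable fun x => F x * h x := by
    refine hfh.mono' ((hFc.continuous.mul hh.continuous).aestronglyMeasurable)
      (Eventually.of_forall fun x => ?_)
    rw [Real.norm_eq_abs, abs_mul, hF, abs_mul]
    simp only
    rw [mul_assoc]
    exact mul_le_mul_of_nonneg_right (hb x) (by positivity)
  have ibp := integral_mul_fderiv_eq_neg_fderiv_mul_of_integrable i1 i2 i3
    (fun x _ => (hFc.differentiable one_ne_zero) x) (fun x _ => (hh.differentiable one_ne_zero) x)
  simp_rw [hFd] at ibp
  simpa [hF] using ibp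

/-- **Skew-symmetry of the angular derivative**: `∫ f ∂_θh = −∫ (∂_θf) h` on `ℝ²` for `C¹`
functions `f, h` with `|x|(|f||h| + |f||Dh| + |Df||h|)` integrable (no boundary terms:
`x^⊥ = (−x₁, x₀)` is divergence-free and the coordinate integrations by parts hold for integrable
products). [folklore] -/
theorem integral_mul_fderiv_perp_eq_neg :
    ∫ x, f x * fderiv ℝ h x (perp x) = -∫ x, fderiv ℝ f x (perp x) * h x := by
  have h01 : (0 : Fin 2) ≠ 1 := by decide
  have h10 : (1 : Fin 2) ≠ 0 := by decide
  have hA := integral_coord_mul_mul_fderiv_eq hf hh hfh hfh' hf'h h01  -- ∫ x₁ f ∂₀h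
  have hB := integral_coord_mul_mul_fderiv_eq hf hh hfh hfh' hf'h h10  -- ∫ x₀ f ∂₁h
  -- integrability of the four coordinate products (for `integral_add`/`integral_sub`)
  have hb : ∀ (x : EuclideanSpace ℝ (Fin 2)) (j : Fin 2), |x j| ≤ ‖x‖ := fun x j => by
    simpa using PiLp.norm_apply_le x j
  have he : ∀ (g : EuclideanSpace ℝ (Fin 2) → ℝ) (x : EuclideanSpace ℝ (Fin 2)) (i : Fin 2),
      |fderiv ℝ g x (EuclideanSpace.single i 1)| ≤ ‖fderiv ℝ g x‖ := fun g x i => by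
    have := (fderiv ℝ g x).le_opNorm (EuclideanSpace.single i 1)
    have hn : ‖EuclideanSpace.single i (1 : ℝ)‖ = 1 := by simp
    rw [hn, mul_one] at this
    simpa using this
  have hpj : ∀ j : Fin 2, Continuous fun x : EuclideanSpace ℝ (Fin 2) => x j := fun j =>
    (EuclideanSpace.proj (j : Fin 2) : EuclideanSpace ℝ (Fin 2) →L[ℝ] ℝ).continuous
  have iL : ∀ i j : Fin 2, Integrable fun x => x j * f x * fderiv ℝ h x (EuclideanSpace.single i 1) := by
    intro i j
    refine hfh'.mono' ((((hpj j).mul hf.continuous).mul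
      ((hh.continuous_fderiv one_ne_zero).clm_apply continuous_const)).aestronglyMeasurable)
      (Eventually.of_forall fun x => ?_)
    rw [Real.norm_eq_abs, abs_mul, abs_mul, mul_assoc]
    exact mul_le_mul (hb x j) (mul_le_mul_of_nonneg_left (he h x i) (abs_nonneg _))
      (by positivity) (norm_nonneg _)
  have iR : ∀ i j : Fin 2, Integrable fun x => x j * fderiv ℝ f x (EuclideanSpace.single i 1) * h x := by
    intro i j
    refine hf'h.mono' ((((hpj j).mul
      ((hf.continuous_fderiv one_ne_zero).clm_apply continuous_const)).mul
      hh.continuous).aestronglyMeasurable) (Eventually.of_forall fun x => ?_)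
    rw [Real.norm_eq_abs, abs_mul, abs_mul, mul_assoc]
    exact mul_le_mul (hb x j) (mul_le_mul_of_nonneg_right (he f x i) (abs_nonneg _))
      (by positivity) (norm_nonneg _)
  have hL : (∫ x, f x * fderiv ℝ h x (perp x)) =
      -(∫ x, x 1 * f x * fderiv ℝ h x (EuclideanSpace.single 0 1)) +
        ∫ x, x 0 * f x * fderiv ℝ h x (EuclideanSpace.single 1 1) := by
    have hneg : Integrable fun x => -(x 1 * f x * fderiv ℝ h x (EuclideanSpace.single 0 1)) :=
      (iL 0 1).neg
    rw [← integral_neg, ← integral_add hneg (iL 1 0)]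
    refine integral_congr_ae (Eventually.of_forall fun x => ?_)
    simp only [fderiv_perp_eq_coord h x]
    ring
  have hR : (∫ x, fderiv ℝ f x (perp x) * h x) =
      -(∫ x, x 1 * fderiv ℝ f x (EuclideanSpace.single 0 1) * h x) +
        ∫ x, x 0 * fderiv ℝ f x (EuclideanSpace.single 1 1) * h x := by
    have hneg : Integrable fun x => -(x 1 * fderiv ℝ f x (EuclideanSpace.single 0 1) * h x) :=
      (iR 0 1).neg
    rw [← integral_neg, ← integral_add hneg (iR 1 0)]
    refine integral_congr_ae (Eventually.of_forall fun x => ?_)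
    simp only [fderiv_perp_eq_coord f x]
    ring
  rw [hL, hR, hA, hB]
  ring

end Skew

/-- **`∫ F g ∂_θg = 0`** for a `C¹` weight `F` with `∂_θF = 0` (e.g. any radial weight) and a
`C¹` function `g` with `|x| |F| g²`, `|x| |F| |g| |Dg|`, `|x| |DF| g²`-type products integrable:
by skew-symmetry `∫ (Fg) ∂_θg = −∫ ∂_θ(Fg) g = −∫ F g ∂_θ g`. This is `⟨Ω∂_θu, F u⟩ = 0`, the
skew-symmetry of `Λ_a = Ω∂_θ` in every radially weighted `L²` (Maekawa 2009, §3: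
"`Λ_a* = −Λ_a`"). [cite: Maekawa2009b, §3] -/
theorem integral_mul_mul_fderiv_perp_eq_zero {F g : EuclideanSpace ℝ (Fin 2) → ℝ}
    (hF : ContDiff ℝ 1 F) (hg : ContDiff ℝ 1 g) (hFθ : ∀ x, fderiv ℝ F x (perp x) = 0)
    (h1 : Integrable fun x => ‖x‖ * (|F x * g x| * |g x|))
    (h2 : Integrable fun x => ‖x‖ * (|F x * g x| * ‖fderiv ℝ g x‖))
    (h3 : Integrable fun x => ‖x‖ * (‖fderiv ℝ (fun y => F y * g y) x‖ * |g x|)) :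
    ∫ x, F x * g x * fderiv ℝ g x (perp x) = 0 := by
  have hFg : ContDiff ℝ 1 fun y => F y * g y := hF.mul hg
  have key := integral_mul_fderiv_perp_eq_neg hFg hg h1 h2 h3
  have hprod : ∀ x, fderiv ℝ (fun y => F y * g y) x (perp x) = F x * fderiv ℝ g x (perp x) := by
    intro x
    have hFx : HasFDerivAt F (fderiv ℝ F x) x := ((hF.differentiable one_ne_zero) x).hasFDerivAt
    have hgx : HasFDerivAt g (fderiv ℝ g x) x := ((hg.differentiable one_ne_zero) x).hasFDerivAt
    rw [(hFx.fun_mul hgx).fderiv]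
    simp [hFθ x]
  simp_rw [hprod] at key
  have : (∫ x, F x * fderiv ℝ g x (perp x) * g x) = ∫ x, F x * g x * fderiv ℝ g x (perp x) :=
    integral_congr_ae (Eventually.of_forall fun x => by ring)
  rw [this] at key
  linarith

/-! ### `Λ = Ω ∂_θ (I + Φ ψ)`: the linearised Burgers operator as an angular derivative -/

/-- The kernel weight on the plane, `y ↦ Φ(|y|)`, is a smooth function of `|y|²`:
`Φ(|y|) = K(|y|²)` with `K(s) = e^{−s/4}/φ(s/4)`. [folklore] -/
theorem kerWeight_norm_eq_comp_normSq (y : EuclideanSpace ℝ (Fin 2)) :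
    kerWeight ‖y‖ = (fun t : ℝ => Real.exp (-(t / 4)) / burgersPhi (t / 4)) (‖y‖ ^ 2) := rfl

/-- `K(s) = e^{−s/4}/φ(s/4)` is differentiable. [folklore] -/
theorem differentiable_kerWeightAux :
    Differentiable ℝ fun s : ℝ => Real.exp (-(s / 4)) / burgersPhi (s / 4) :=
  (Real.differentiable_exp.comp ((differentiable_id.div_const 4).neg)).div
    ((contDiff_burgersPhi (n := 1)).differentiable one_ne_zero |>.comp
      (differentiable_id.div_const 4)) fun _ => (burgersPhi_pos _).ne'

/-- `y ↦ Φ(|y|)` is differentiable … [folklore] -/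
theorem differentiableAt_kerWeight_norm (y : EuclideanSpace ℝ (Fin 2)) :
    DifferentiableAt ℝ (fun y : EuclideanSpace ℝ (Fin 2) => kerWeight ‖y‖) y := by
  simp_rw [kerWeight_norm_eq_comp_normSq]
  exact (differentiable_kerWeightAux _).comp y
    (hasStrictFDerivAt_norm_sq y).hasFDerivAt.differentiableAt

/-- … and radial: `∂_θ Φ(|·|) = 0`. [folklore] -/
theorem fderiv_kerWeight_norm_perp (y : EuclideanSpace ℝ (Fin 2)) :
    fderiv ℝ (fun y : EuclideanSpace ℝ (Fin 2) => kerWeight ‖y‖) y (perp y) = 0 := by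
  simp_rw [kerWeight_norm_eq_comp_normSq]
  exact fderiv_perp_eq_zero_of_radial (differentiable_kerWeightAux _)

/-- **`Λw = Ω ∂_θ(w + Φψ)` (Maekawa's skew-symmetrizer, pointwise).** For the linearisation
`Λw = ⟪v^G, ∇w⟫ + ⟪K_{2D}∗w, ∇G⟫` at the Gaussian vortex (`gaussVortexVelocity`,
`gaussVortexProfile`, `biotSavart2D`), any `w` differentiable at `ξ` and ANY `ψ` differentiable at
`ξ` with `Dψ(ξ)[ξ^⊥] = −⟪(K_{2D}∗w)(ξ), ξ⟫` (a stream function: `∇ψ = −v^⊥`):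
`Λw(ξ) = (G(ξ)/(2Φ(|ξ|))) · D(w + Φ(|·|)ψ)(ξ)[ξ^⊥]`, where `G/(2Φ) = Ω = (8π)⁻¹φ(|ξ|²/4)` is the
angular velocity of the vortex and `Φ = kerWeight`. Indeed `⟪v^G, ∇w⟫ = Ω ∂_θw`,
`⟪v, ∇G⟫ = −(G/2)⟪v, ξ⟫ = (G/2)∂_θψ` and `∂_θΦ = 0`. (Maekawa 2009, Lemma 1.1: `ΛT = Λ_a`
with `Λ_a = Ω∂_θ`, `T⁻¹ = I + Λ_a⁻¹Λ_b`; here `T⁻¹w = w + Φψ`.) [cite: Maekawa2009b, Lemma 1.1] -/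
theorem gaussLambda_eq_mul_fderiv_perp {w ψ : EuclideanSpace ℝ (Fin 2) → ℝ}
    {ξ : EuclideanSpace ℝ (Fin 2)} (hw : DifferentiableAt ℝ w ξ) (hψ : DifferentiableAt ℝ ψ ξ)
    (hψθ : fderiv ℝ ψ ξ (perp ξ) = -⟪biotSavart2D w ξ, ξ⟫) :
    ⟪gaussVortexVelocity ξ, gradient w ξ⟫ + ⟪biotSavart2D w ξ, gradient gaussVortexProfile ξ⟫ =
      gaussVortexProfile ξ / (2 * kerWeight ‖ξ‖) *
        fderiv ℝ (fun y => w y + kerWeight ‖y‖ * ψ y) ξ (perp ξ) := by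
  -- the angular derivative of `u = w + Φψ`
  have hΦ := differentiableAt_kerWeight_norm ξ
  have hu : fderiv ℝ (fun y => w y + kerWeight ‖y‖ * ψ y) ξ (perp ξ) =
      fderiv ℝ w ξ (perp ξ) - kerWeight ‖ξ‖ * ⟪biotSavart2D w ξ, ξ⟫ := by
    have hw' : HasFDerivAt w (fderiv ℝ w ξ) ξ := hw.hasFDerivAt
    have hψ' : HasFDerivAt ψ (fderiv ℝ ψ ξ) ξ := hψ.hasFDerivAt
    have hΦ' : HasFDerivAt (fun y : EuclideanSpace ℝ (Fin 2) => kerWeight ‖y‖)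
        (fderiv ℝ (fun y : EuclideanSpace ℝ (Fin 2) => kerWeight ‖y‖) ξ) ξ := hΦ.hasFDerivAt
    rw [(hw'.fun_add (hΦ'.fun_mul hψ')).fderiv]
    simp only [_root_.add_apply, _root_.smul_apply, smul_eq_mul,
      fderiv_kerWeight_norm_perp, hψθ]
    ring
  -- the two inner products
  have h1 : ⟪gaussVortexVelocity ξ, gradient w ξ⟫ =
      (8 * π)⁻¹ * burgersPhi (‖ξ‖ ^ 2 / 4) * fderiv ℝ w ξ (perp ξ) := by
    rw [gaussVortexVelocity, real_inner_smul_left, real_inner_comm, gradient,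
      InnerProductSpace.toDual_symm_apply]
  have h2 : ⟪biotSavart2D w ξ, gradient gaussVortexProfile ξ⟫ =
      -(gaussVortexProfile ξ / 2) * ⟪biotSavart2D w ξ, ξ⟫ := by
    rw [real_inner_comm, gradient, InnerProductSpace.toDual_symm_apply,
      fderiv_gaussVortexProfile_apply, real_inner_comm]
  rw [hu, h1, h2, kerWeight_norm_eq]
  have hG : gaussVortexProfile ξ ≠ 0 := (gaussVortexProfile_pos ξ).ne'
  have hφ : burgersPhi (‖ξ‖ ^ 2 / 4) ≠ 0 := (burgersPhi_pos _).ne'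
  have hπ : (π : ℝ) ≠ 0 := Real.pi_pos.ne'
  field_simp
  ring

end Literature.Analysis.FluidPDE
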